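import Literature.AlgebraicGeometry.Frobenioids.PadicFrobenioidQpSplit
import Literature.AlgebraicGeometry.Frobenioids.ModelFrobenioidMap
import Literature.IUT.LogThetaLattice.PerpPrimeStrips
import Mathlib.CategoryTheory.Category.Cat
import Mathlib.CategoryTheory.SingleObj
import HarnessLib

/-!
# [IUTchIII] Definition 2.4 (i)–(iii): the local data `PerpLocalData` is GENUINELY inhabited at good
# nonarchimedean places — split `p_v`-adic Frobenioids and the [FrdI] Prop. 5.3 functor "replace `O^▷` by `O^⊥`"

S. Mochizuki, *Inter-universal Teichmüller theory III*, kurims manuscript (May 2020), §2, Definition 2.4 (i) pp. 87–88: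
«for each `w ∈ V̲^{good}`, the splitting of the split Frobenioid `‡F^⊢_w` determines a submonoid "`O^⊥(−) ⊆ O^▷(−)`" whose
subgroup of units is trivial …; in this case, we set `O^▶(−) := O^⊥(−)`. Write `‡F^{⊢⊥} = {‡F^{⊢⊥}_v}`; `‡F^{⊢▶} = {‡F^{⊢▶}_v}`
for the collections of data obtained by replacing the split Frobenioid portion of each `‡F^⊢_v` by the Frobenioids
determined, respectively, by the subquotient monoids "`O^⊥(−) ⊆ O^▷(−)`", "`O^▶(−)`"», Def. 2.4 (iii) pp. 88–89 (the
`F^{⊩⊥}`-prime-strips); [IUTchI] Example 3.3 (i) (the split Frobenioid `F^⊢_v = (C^⊢_v, τ^⊢_v)` at `v ∈ V̲^{good} ∩ V̲^{non}`,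
"the element `p_v ∈ ℤ_{p_v}^⊳` determines a characteristic splitting"); S. Mochizuki, *The geometry of Frobenioids I*,
Kyushu J. Math. **62** (2008), Prop. 5.3 p. 103 (the functors of model Frobenioids induced by morphisms of model data)
and Thm. 5.2 p. 100 (model Frobenioids); *The geometry of Frobenioids II*, Example 1.1 (ii) p. 8 (`p`-adic Frobenioids).
[claim: Mochizuki2012, status: disputed] for every [IUTch] sentence; the [FrdI]/[FrdII] inputs are classical and landed.

PROOF-ONLY file (abc-iut cell, layer L6, seat abc-iut-w5-d146 gen 2; L6-lead §F v1.19c (2) / v1.19e (2) row «NV-L6-UPGRADE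
PerpLocalData, GENUINE»). No definition, no instance: every witness is built inside a theorem term, and the STATEMENTS pin
the witnesses through `Cat.of`-equalities (carrier AND category structure), so that "genuine" is part of what is proved,
not only of how it is proved. Before this file the interface `PerpLocalData` of abc-iut-L6-t3 (`PerpPrimeStrips.lean`,
a STUB whose docstring records that it «does not tie `toPerp`/`toTri` to "the Frobenioid determined by" these monoids
([FrdI] Thm 5.2, owner abc-iut-L1)») had only the DEGENERATE producer `PerpLocalData.trivial` (one-point categories,
`InterfaceNonVacuity.lean`).

THE MODEL (good nonarchimedean places, `K_v = ℚ_{p_v}`). Fix any label type `V` and any assignment of residue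
characteristics `p : V → ℕ` (all prime). At each `v`:
* `Fv v := PadicFrd.CDashQp (p v)` — abc-iut-L1-t4's split `p_v`-adic Frobenioid `C^⊢(ℚ_{p_v})` of [FrdII] Ex. 1.1 (ii) /
  [IUTchI] Ex. 3.3 (i) over the one-object base `Spec ℚ_{p_v}`, an honest `ModelFrobenioid` ([FrdI] Thm. 5.2) with every
  hypothesis of the `p`-adic construction discharged (`PadicFrobenioidQpSplit.lean`), characteristic splitting `τQp`
  determined by `p_v`; divisor monoid `Φ = ord(ℤ_{p_v}^⊳) = ℤ_{≥0}·ord(p_v)`, rational-function monoid `B`, `Div_B : B → Φ^gp`.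
* `Fperp v = Ftri v := ModelFrobenioid Φ Φ^gp (𝟙 Φ^gp)` — «the Frobenioid determined by the monoid `O^⊥(−) = p_v^ℕ`»: the
  units of `O^⊥` are trivial (`padic_perp_units_eq_one` below), so its divisor monoid `O^⊥/O^{⊥×}` is `Φ` itself, its
  groupification `(O^⊥)^gp = p_v^ℤ` is `Φ^gp`, and `Div` is the identity; print's «we set `O^▶(−) := O^⊥(−)`» ⇒ `Ftri = Fperp`.
* `toPerp v = toTri v := ModelFrobenioid.DataHom.functor ⟨η := 𝟙 Φ, β := Div_B, _⟩` — abc-iut-L1-t2's [FrdI] Prop. 5.3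
  functor of the morphism of model data `(Φ, B, Div_B) → (Φ, Φ^gp, id)`: «replacing the split Frobenioid portion … by the
  Frobenioid determined by `O^⊥`» = keep base and divisors, send the unit/rational-function coordinate `u` of a morphism
  to `Div_B(u)` (kill `O^×` along the splitting). Compatibility `id^gp ∘ Div_B = id ∘ Div_B` is `MonGp.map_id`.
* `modelFv v := (Spec ℚ_{p_v}, trivial class)`; `monoids v X := ⟨O^▷ := ℤ_{p_v}^⊳ (= PadicFrd.intNonzero ℚ_[p v]),
  O^⊥ := Submonoid.powers p_v⟩` ([IUTchII] Def. 4.9 (iv): the submonoid generated by the image of the splitting).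

DECLARATIONS. `PerpLocalData.exists_padicModel` (the model, with its defining clauses in the statement);
`PerpMonoidData.padic_perp_units_eq_one` / `padic_toTri_bijective` (print «whose subgroup of units is trivial … `O^▶ := O^⊥`»:
the quotient map `O^⊥ ↠ O^▶ = O^⊥/torsion` of abc-iut-L6-t3's `PerpMonoidData.toTri` is a bijection at these monoids);
`PerpLocalData.exists_padicModel_fglPerpStrip` (the genuine local data enter Def. 2.4 (iii): over them and the degree
frame of abc-iut-w5-d112's `GlobalRealifiedFrame.nonempty_model` — re-entered verbatim, a `Nonempty` witness not being
consumable by name — the category of `F^{⊩⊥}`-prime-strips `FglPerpStrip` is inhabited; universes `{0, w}` fit).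

HONEST LABEL: GENUINE at GOOD NONARCHIMEDEAN places with `K_v = ℚ_{p_v}` only (finite extensions `K_v/ℚ_{p_v}`: the same
code over `PadicFrd.Datum.prim base` once wanted); the bad-place clause (`O^▶ = O^⊥/O^μ_{2l}`, [IUTchIII] Def. 2.4 (i)
first sentence) and archimedean places are NOT modelled here; inhabited ≠ endorsed; nothing in this file asserts a
disputed claim or takes a side on [IUTchIII] Cor. 3.12.
-/

namespace Literature.IUT.LogThetaLattice

open CategoryTheory Opposite Literature.AlgebraicGeometry.Frobenioids

universe w

/-- **IUTchIII:Def2.4(i)** (kurims pp.87–88) **`PerpLocalData` is GENUINELY inhabited at good nonarchimedean places**: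
for every label type `V` and residue characteristics `p : V → ℕ`, there is a `PerpLocalData.{0, w} V` whose ambient
category at `v` IS the split `p_v`-adic Frobenioid `C^⊢(ℚ_{p_v})` ([FrdII] Ex. 1.1 (ii), [IUTchI] Ex. 3.3 (i)), whose
`F^{⊢⊥}`/`F^{⊢▶}`-categories ARE the model Frobenioid `(Φ, Φ^gp, id)` determined by the monoid `O^⊥ = p_v^ℕ`, whose passages
`toPerp = toTri` ARE the [FrdI] Prop. 5.3 functor of the data morphism `(𝟙_Φ, Div_B)` ("replace `O^▷` by `O^⊥`"), and whose
monoid data are `O^⊥ = p_v^ℕ ⊆ ℤ_{p_v}^⊳ = O^▷`. [claim: Mochizuki2012, status: disputed] -/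
theorem PerpLocalData.exists_padicModel (V : Type w) (p : V → ℕ) [∀ v, Fact (p v).Prime] :
    ∃ P : PerpLocalData.{0, w} V,
      (∀ v, Cat.of (P.Fv v) = Cat.of (PadicFrd.CDashQp (p v))) ∧
      (∀ v, Cat.of (P.Fperp v) =
        Cat.of (ModelFrobenioid (PadicFrd.Datum.primQp (p v)).Φ (monoidGp (PadicFrd.Datum.primQp (p v)).Φ) (𝟙 _))) ∧
      (∀ v, Cat.of (P.Ftri v) = Cat.of (P.Fperp v)) ∧
      HEq P.toTri P.toPerp ∧
      (∀ v, ∃ h : ModelFrobenioid.DataHom (PadicFrd.Datum.primQp (p v)).divB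
          (𝟙 (monoidGp (PadicFrd.Datum.primQp (p v)).Φ)),
        h.η = 𝟙 _ ∧ h.β = (PadicFrd.Datum.primQp (p v)).divB ∧ HEq (P.toPerp v) h.functor) ∧
      (∀ v, HEq (P.modelFv v)
        (⟨⟨PUnit.unit⟩, 1⟩ : PadicFrd.CDashQp (p v))) ∧
      (∀ v (X : P.Fv v), P.monoids v X =
        { O := PadicFrd.intNonzero ℚ_[p v]
          perp := Submonoid.powers ⟨(p v : ℚ_[p v]), PadicFrd.p_mem_intNonzero (p v)⟩ }) := by
  let h : ∀ v, ModelFrobenioid.DataHom (PadicFrd.Datum.primQp (p v)).divB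
      (𝟙 (monoidGp (PadicFrd.Datum.primQp (p v)).Φ)) := fun v =>
    { η := 𝟙 _
      β := (PadicFrd.Datum.primQp (p v)).divB
      comm := fun A u => by
        simp only [gpApp, NatTrans.id_app, CommMonCat.hom_id, MonGp.map_id, MonoidHom.id_apply]
        rfl }
  exact
    ⟨{ Fv := fun v => PadicFrd.CDashQp (p v)
       Fperp := fun v =>
         ModelFrobenioid (PadicFrd.Datum.primQp (p v)).Φ (monoidGp (PadicFrd.Datum.primQp (p v)).Φ) (𝟙 _)
       Ftri := fun v =>
         ModelFrobenioid (PadicFrd.Datum.primQp (p v)).Φ (monoidGp (PadicFrd.Datum.primQp (p v)).Φ) (𝟙 _)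
       modelFv := fun v => ⟨⟨PUnit.unit⟩, 1⟩
       toPerp := fun v => (h v).functor
       toTri := fun v => (h v).functor
       monoids := fun v _ =>
         { O := PadicFrd.intNonzero ℚ_[p v]
           perp := Submonoid.powers ⟨(p v : ℚ_[p v]), PadicFrd.p_mem_intNonzero (p v)⟩ } },
      fun _ => rfl, fun _ => rfl, fun _ => rfl, HEq.rfl, fun v => ⟨h v, rfl, rfl, HEq.rfl⟩, fun _ => HEq.rfl,
      fun _ _ => rfl⟩

/-- Units of the submonoid `x^ℕ` generated by an element `x` of norm `< 1` of `ℤ_p^⊳` are trivial (`x` is not a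
root of unity). [folklore] -/
private theorem PerpMonoidData.padic_powers_units_eq_one (p : ℕ) [Fact p.Prime] (x : PadicFrd.intNonzero ℚ_[p])
    (hx : ‖(x : ℚ_[p])‖ < 1) (u : (Submonoid.powers x)ˣ) : u = 1 := by
  obtain ⟨n, hn⟩ := (Submonoid.mem_powers_iff _ _).1 u.val.property
  obtain ⟨m, hm⟩ := (Submonoid.mem_powers_iff _ _).1 u.inv.property
  have h1 : ((u.val : PadicFrd.intNonzero ℚ_[p]) : ℚ_[p]) * ((u.inv : PadicFrd.intNonzero ℚ_[p]) : ℚ_[p]) = 1 := by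
    have hu := congrArg (fun y : Submonoid.powers x => ((y : PadicFrd.intNonzero ℚ_[p]) : ℚ_[p])) u.val_inv
    simpa only [Submonoid.coe_mul, Submonoid.coe_one, OneMemClass.coe_one] using hu
  rw [← hn, ← hm, SubmonoidClass.coe_pow, SubmonoidClass.coe_pow, ← pow_add] at h1
  have hnm : n + m = 0 := by
    by_contra hne
    have hlt := pow_lt_one₀ (norm_nonneg (x : ℚ_[p])) hx hne
    rw [← norm_pow, h1, norm_one] at hlt
    exact lt_irrefl _ hlt
  apply Units.ext
  apply Subtype.ext
  rw [← hn, Nat.eq_zero_of_add_eq_zero_right hnm, pow_zero, Units.val_one, OneMemClass.coe_one]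

/-- **IUTchIII:Def2.4(i)** (kurims p.88) «a submonoid "`O^⊥(−) ⊆ O^▷(−)`" whose subgroup of units is trivial»: in
`O^▷ = ℤ_p^⊳` the submonoid `O^⊥ = p^ℕ` generated by the splitting element `p` has no unit but `1` (`‖p‖_p < 1`).
[claim: Mochizuki2012, status: disputed] -/
theorem PerpMonoidData.padic_perp_units_eq_one (p : ℕ) [Fact p.Prime]
    (u : (Submonoid.powers (⟨(p : ℚ_[p]), PadicFrd.p_mem_intNonzero p⟩ : PadicFrd.intNonzero ℚ_[p]))ˣ) :
    u = 1 :=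
  PerpMonoidData.padic_powers_units_eq_one p _ (Padic.norm_p_lt_one (p := p)) u

/-- **IUTchIII:Def2.4(i)** (kurims p.88) «in this case, we set `O^▶(−) := O^⊥(−)`»: at the genuine `p`-adic monoid data
`(O^▷, O^⊥) = (ℤ_p^⊳, p^ℕ)` the quotient map `O^⊥ ↠ O^▶ = O^⊥/(torsion)` (abc-iut-L6-t3's `PerpMonoidData.toTri`) is a
bijection. [claim: Mochizuki2012, status: disputed] -/
theorem PerpMonoidData.padic_toTri_bijective (p : ℕ) [Fact p.Prime] :
    Function.Bijective
      (PerpMonoidData.toTri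
        { O := PadicFrd.intNonzero ℚ_[p]
          perp := Submonoid.powers ⟨(p : ℚ_[p]), PadicFrd.p_mem_intNonzero p⟩ }) :=
  haveI : Subsingleton
      (Submonoid.powers (⟨(p : ℚ_[p]), PadicFrd.p_mem_intNonzero p⟩ : PadicFrd.intNonzero ℚ_[p]))ˣ :=
    ⟨fun a b => by rw [PerpMonoidData.padic_perp_units_eq_one p a, PerpMonoidData.padic_perp_units_eq_one p b]⟩
  PerpMonoidData.toTri_bijective_of_units_trivial _

/-- **IUTchIII:Def2.4(iii)** (kurims pp.88–89) the genuine local data enter the `F^{⊩⊥}`-prime-strips: over the `p`-adic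
model of `exists_padicModel` and the degree frame of `GlobalRealifiedFrame.nonempty_model` (abc-iut-w5-d112; re-entered
verbatim: `GR = TM = B ℝ_{>0}`, `Φ` diagonal, `Φ^{rlf}` trivial on isomorphisms) at `Str := P.FperpStrip`, with model
quadruple `(∗, model strip, ρ_v = id)`, the category `FglPerpStrip P Q M` of `F^{⊩⊥}`-prime-strips is inhabited.
[claim: Mochizuki2012, status: disputed] -/
theorem PerpLocalData.exists_padicModel_fglPerpStrip (V : Type w) (p : V → ℕ) [∀ v, Fact (p v).Prime] :
    ∃ (P : PerpLocalData.{0, w} V) (Q : GlobalRealifiedFrame.{0, w} V P.FperpStrip) (M : GlQuadruple Q),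
      (∀ v, Cat.of (P.Fv v) = Cat.of (PadicFrd.CDashQp (p v))) ∧ Nonempty (FglPerpStrip P Q M) := by
  obtain ⟨P, hP, -⟩ := PerpLocalData.exists_padicModel V p
  let Q : GlobalRealifiedFrame.{0, w} V P.FperpStrip :=
    { GR := SingleObj (Multiplicative ℝ)
      TM := SingleObj (Multiplicative ℝ)
      Φ := Functor.pi' fun _ : V => 𝟭 (SingleObj (Multiplicative ℝ))
      Φrlf := Functor.pi' fun _ : V => (Functor.const P.FperpStrip).obj (SingleObj.star (Multiplicative ℝ)) }
  let M : GlQuadruple Q :=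
    { left := SingleObj.star (Multiplicative ℝ)
      right := (StripCat.model : P.FperpStrip)
      hom := fun _ => 𝟙 (SingleObj.star (Multiplicative ℝ)) }
  exact ⟨P, Q, M, hP, ⟨⟨⟨M, ⟨Iso.refl M⟩⟩⟩⟩⟩

end Literature.IUT.LogThetaLattice
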